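import Summits.QuantumFields.YangMills.Theses.ConvexGribovBody
import Summits.QuantumFields.YangMills.Theorems.OneCertifiedCubeFiniteSizeCriterion
import HarnessLib

/-!
# `NonSimplyConnectedLatticeGap` — the transfer of line `Sketch` v5: weak mixing on cubes ⇒ crux
# (stub `stub_cruxOfBoxInfluenceDecayNSC` of crux stmt-QuantumFields-16405, route `ConvexGribovBody`)

If for every compact simple `G` with `¬ SimplyConnectedSpace G` and faithful unitary `r` there is `β₂` such that at every
`β ≥ β₂` the Wilson specification `ymSpecification r.ρ β` is weakly mixing on cubes for gauge-invariant local observables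
(`|γ_{Λ_L}(A|η) − γ_{Λ_L}(A|η')| ≤ C_A e^{−mL}` on `Λ_L = [−L,L]⁴ × (4 directions)`, all exterior data), then the crux:
on the torus `(2S+1)⁴` with `t ≤ S` the cube of radius `L = t − R_B − 1` around the support of `A` injects into the torus
with its collar and misses the support of `τ_t B`, so `FiniteSizeCriterion.abs_latticeConnectedCorr_le_of_influence`
(far-factor DLR transfer + translation invariance, Georgii 2011 §8.2) gives `|⟨A; τ_t B⟩| ≤ ‖B‖∞ C_A e^{−mL} ≤ C e^{−mt}`;
for `t < R_A + R_B + 2` the trivial bound `2‖A‖∞‖B‖∞` suffices. Template: `FiniteSizeCriterion_proof`.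
-/

set_option autoImplicit false

noncomputable section

open MeasureTheory Filter
open Literature.Probability.LatticeModels
open Literature.MathematicalPhysics.QuantumLattice
open Literature.MathematicalPhysics.QuantumFieldTheory (wilsonMeasure isProbabilityMeasure_wilsonMeasure
  latticeConnectedCorr measurable_torusLift isSpecification_ymSpecification_of_t2Space)

namespace Summit.QuantumFields.YangMills.Theorems.NonSimplyConnectedLatticeGap

/-- **Weak mixing on cubes at large `β` ⇒ `NonSimplyConnectedLatticeGap`** (registered stub
`stub_cruxOfBoxInfluenceDecayNSC` of the skeleton `Cruxes/NonSimplyConnectedLatticeGap/Lines/Sketch.lean` v5 of item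
stmt-QuantumFields-16405; far-factor DLR transfer on the torus, rate preserved, `S₁ = 0`). -/
theorem stub_cruxOfBoxInfluenceDecayNSC : (∀ (G : Type) [Group G] [TopologicalSpace G] [IsTopologicalGroup G] [CompactSpace G] [MeasurableSpace G] [BorelSpace G], Literature.MathematicalPhysics.QuantumFieldTheory.IsCompactSimpleLieGroup G → ¬ SimplyConnectedSpace G → ∀ r : Literature.MathematicalPhysics.QuantumFieldTheory.LatticeRep G, ∃ β₂ : ℝ, ∀ β : ℝ, β₂ ≤ β → ∃ m : ℝ, 0 < m ∧ ∀ A : Literature.MathematicalPhysics.QuantumFieldTheory.YMSpecies G, ∃ C : ℝ, ∀ (L : ℕ) (η η' : Literature.MathematicalPhysics.QuantumLattice.LGConfig 4 G), |(∫ U, A.F U ∂(Literature.MathematicalPhysics.QuantumLattice.ymSpecification r.ρ β ((Fintype.piFinset fun _ : Fin 4 => Finset.Icc (-((L : ℕ) : ℤ)) ((L : ℕ) : ℤ)) ×ˢ (Finset.univ : Finset (Fin 4))) η)) - ∫ U, A.F U ∂(Literature.MathematicalPhysics.QuantumLattice.ymSpecification r.ρ β ((Fintype.piFinset fun _ : Fin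 4 => Finset.Icc (-((L : ℕ) : ℤ)) ((L : ℕ) : ℤ)) ×ˢ (Finset.univ : Finset (Fin 4))) η')| ≤ C * Real.exp (-(m * L))) → Summit.QuantumFields.YangMills.Theses.ConvexGribovBody.NonSimplyConnectedLatticeGap := by
  intro H
  unfold Summit.QuantumFields.YangMills.Theses.ConvexGribovBody.NonSimplyConnectedLatticeGap
  intro G _ _ _ _ _ _ hG hnsc r
  obtain ⟨β₂, hβ₂⟩ := H G hG hnsc r
  refine ⟨β₂, fun β hβ => ?_⟩
  obtain ⟨m, hm, hAll⟩ := hβ₂ β hβ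
  refine ⟨m, hm, 0, fun A B => ?_⟩
  haveI : T2Space G := (r.continuous.isClosedEmbedding r.injective).isEmbedding.t2Space
  haveI : SecondCountableTopology G :=
    (r.continuous.isClosedEmbedding r.injective).isEmbedding.secondCountableTopology
  obtain ⟨CA, hCA⟩ := A.bounded
  obtain ⟨CB, hCB⟩ := B.bounded
  have hCA0 : 0 ≤ CA := (abs_nonneg _).trans (hCA fun _ => 1)
  have hCB0 : 0 ≤ CB := (abs_nonneg _).trans (hCB fun _ => 1)
  -- the radii of the supports
  set RA : ℕ := A.supp.sup fun e => Finset.univ.sup fun i => (e.1 i).natAbs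
  set RB : ℕ := B.supp.sup fun e => Finset.univ.sup fun i => (e.1 i).natAbs
  have hRA : ∀ e ∈ A.supp, ∀ i, |e.1 i| ≤ RA := fun e he i => by
    rw [Int.abs_eq_natAbs, Int.ofNat_le]
    exact (Finset.le_sup (f := fun i => (e.1 i).natAbs) (Finset.mem_univ i)).trans
      (Finset.le_sup (f := fun e : ZdEdge 4 => Finset.univ.sup fun i => (e.1 i).natAbs) he)
  have hRB : ∀ e ∈ B.supp, ∀ i, |e.1 i| ≤ RB := fun e he i => by
    rw [Int.abs_eq_natAbs, Int.ofNat_le]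
    exact (Finset.le_sup (f := fun i => (e.1 i).natAbs) (Finset.mem_univ i)).trans
      (Finset.le_sup (f := fun e : ZdEdge 4 => Finset.univ.sup fun i => (e.1 i).natAbs) he)
  clear_value RA RB
  -- the cube-influence constant of `A`
  obtain ⟨KA, hKA⟩ := hAll A
  have hKA0 : 0 ≤ KA := by
    have h1 : (0 : ℝ) ≤ KA * Real.exp (-(m * ((0 : ℕ) : ℝ))) := (abs_nonneg _).trans (hKA 0 1 1)
    simpa using h1
  -- the constant
  refine ⟨2 * CA * CB * Real.exp (m * (RA + RB + 2)) + CB * KA * Real.exp (m * (RB + 1)), ?_⟩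
  intro S t _ ht
  haveI := isProbabilityMeasure_wilsonMeasure (d := 4) (L := 2 * S + 1) r.ρ r.continuous β
  -- the trivial bound
  have htriv : |latticeConnectedCorr r.ρ β (2 * S + 1) A.F B.F t| ≤ 2 * CA * CB := by
    unfold Literature.MathematicalPhysics.QuantumFieldTheory.latticeConnectedCorr
    have h1 : |∫ U, A.F (torusLift (2 * S + 1) U) *
        B.F (Literature.MathematicalPhysics.QuantumLattice.configShift (-Pi.single 0 (t : ℤ))
          (torusLift (2 * S + 1) U)) ∂(wilsonMeasure (d := 4) (L := 2 * S + 1) r.ρ β)| ≤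
        CA * CB :=
      abs_integral_le_of_abs_le fun U => by
        rw [abs_mul]
        exact mul_le_mul (hCA _) (hCB _) (abs_nonneg _) hCA0
    have h2 : |∫ U, A.F (torusLift (2 * S + 1) U) ∂(wilsonMeasure (d := 4) (L := 2 * S + 1) r.ρ β)|
        ≤ CA := abs_integral_le_of_abs_le fun U => hCA _
    have h3 : |∫ U, B.F (torusLift (2 * S + 1) U) ∂(wilsonMeasure (d := 4) (L := 2 * S + 1) r.ρ β)|
        ≤ CB := abs_integral_le_of_abs_le fun U => hCB _
    calc _ ≤ |∫ U, A.F (torusLift (2 * S + 1) U) *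
          B.F (Literature.MathematicalPhysics.QuantumLattice.configShift (-Pi.single 0 (t : ℤ))
            (torusLift (2 * S + 1) U)) ∂(wilsonMeasure (d := 4) (L := 2 * S + 1) r.ρ β)| +
          |(∫ U, A.F (torusLift (2 * S + 1) U) ∂(wilsonMeasure (d := 4) (L := 2 * S + 1) r.ρ β)) *
            ∫ U, B.F (torusLift (2 * S + 1) U) ∂(wilsonMeasure (d := 4) (L := 2 * S + 1) r.ρ β)| :=
          abs_sub _ _
      _ ≤ CA * CB + CA * CB := by
          rw [abs_mul]
          exact add_le_add h1 (mul_le_mul h2 h3 (abs_nonneg _) hCA0)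
      _ = 2 * CA * CB := by ring
  by_cases hcase : RA + RB + 2 ≤ t
  swap
  · -- the supports are close in time: the trivial bound suffices
    have htlt : (t : ℝ) < RA + RB + 2 := by exact_mod_cast (not_le.1 hcase)
    have hexp : 1 ≤ Real.exp (m * (RA + RB + 2)) * Real.exp (-(m * t)) := by
      rw [← Real.exp_add]
      refine Real.one_le_exp ?_
      have h := mul_lt_mul_of_pos_left htlt hm
      linarith only [h]
    calc |latticeConnectedCorr r.ρ β (2 * S + 1) A.F B.F t| ≤ 2 * CA * CB := htriv
      _ = 2 * CA * CB * 1 + 0 := by ring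
      _ ≤ 2 * CA * CB * (Real.exp (m * (RA + RB + 2)) * Real.exp (-(m * t))) +
            CB * KA * Real.exp (m * (RB + 1)) * Real.exp (-(m * t)) := by
          gcongr
          positivity
      _ = (2 * CA * CB * Real.exp (m * (RA + RB + 2)) + CB * KA * Real.exp (m * (RB + 1))) *
            Real.exp (-(m * t)) := by ring
  · -- the main case: the cube of radius `L = t - R_B - 1` with its collar fits strictly between
    -- the support of `A` and the time-`t` translate of the support of `B`
    obtain ⟨L, hL⟩ : ∃ L : ℕ, L = t - RB - 1 := ⟨_, rfl⟩
    have hLt : L + RB + 1 = t := by omega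
    have hRAL : RA + 1 ≤ L := by omega
    have hLS : L + 1 ≤ S := by omega
    -- integer forms of the separation facts
    have hI1 : (L : ℤ) + RB + 1 = t := by exact_mod_cast hLt
    have hI2 : (t : ℤ) ≤ S := by exact_mod_cast ht
    have hRAL' : (RA : ℤ) + 1 ≤ L := by exact_mod_cast hRAL
    have hLS' : (L : ℤ) + 1 ≤ S := by exact_mod_cast hLS
    -- the cube `Λ` of radius `L`
    obtain ⟨Λ, hΛ⟩ : ∃ Λ : Finset (ZdEdge 4), Λ = (Fintype.piFinset fun _ : Fin 4 =>
      Finset.Icc (-((L : ℕ) : ℤ)) ((L : ℕ) : ℤ)) ×ˢ (Finset.univ : Finset (Fin 4)) := ⟨_, rfl⟩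
    have hmemΛ : ∀ e ∈ Λ, ∀ i, -(L : ℤ) ≤ e.1 i ∧ e.1 i ≤ L := by
      intro e he i
      rw [hΛ, Finset.mem_product, Fintype.mem_piFinset] at he
      exact Finset.mem_Icc.1 (he.1 i)
    -- (i) `Λ`, the support of `A` and the collar of `Λ` inject into the torus
    have hwide : ∀ e ∈ Λ ∪ A.supp ∪ (plaquettesTouching Λ).biUnion plaquetteEdges, ∀ i,
        -(L : ℤ) - 1 ≤ e.1 i ∧ e.1 i ≤ L + 1 := by
      intro e he i
      simp only [Finset.mem_union] at he
      rcases he with (he | he) | he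
      · have h := hmemΛ e he i
        constructor <;> linarith only [h.1, h.2]
      · have h := abs_le.1 (hRA e he i)
        constructor <;> linarith only [h.1, h.2, hRAL']
      · obtain ⟨e', he', hn'⟩ := exists_near_of_mem_collar he
        have h := hmemΛ e' he' i
        have h' := hn' i
        constructor <;> linarith only [h.1, h.2, h'.1, h'.2]
    have hinj : Set.InjOn (Torus.proj (2 * S + 1))
        ((Λ ∪ A.supp ∪ (plaquettesTouching Λ).biUnion plaquetteEdges).image Prod.fst :
          Set (Site 4)) := by
      refine (FiniteSizeCriterion.injOn_torusProj_of_width (M := 2 * S + 1) (lo := -(L : ℤ) - 1)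
        (hi := (L : ℤ) + 1) (by push_cast; linarith only [hLS'])).mono fun x hx => ?_
      obtain ⟨e, he, rfl⟩ := Finset.mem_image.1 (Finset.mem_coe.1 hx)
      exact hwide e he
    -- (ii) the torus image of `Λ` misses the translate of the support of `B`
    have hfar : ∀ e ∈ B.supp.image (fun e : ZdEdge 4 => (e.1 - -Pi.single 0 (t : ℤ), e.2)),
        ∀ e' ∈ Λ, torusEdge (2 * S + 1) e ≠ torusEdge (2 * S + 1) e' := by
      intro e he e' he' heq
      obtain ⟨e₀, he₀, rfl⟩ := Finset.mem_image.1 he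
      have h0 := abs_le.1 (hRB e₀ he₀ 0)
      have h1 := hmemΛ e' he' 0
      have hproj : ((e₀.1 0 + t : ℤ) : ZMod (2 * S + 1)) = ((e'.1 0 : ℤ) : ZMod (2 * S + 1)) := by
        have h := congr_fun (congr_arg Prod.fst heq) 0
        simp only [torusEdge] at h
        simpa [Torus.proj_apply] using h
      rw [ZMod.intCast_eq_intCast_iff_dvd_sub] at hproj
      -- `0 < (e₀.1 0 + t) - e'.1 0 < 2S+1`, contradicting divisibility
      have hpos : 0 < e₀.1 0 + t - e'.1 0 := by linarith only [h0.1, h1.2, hI1]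
      have hlt' : e₀.1 0 + t - e'.1 0 < ((2 * S + 1 : ℕ) : ℤ) := by
        push_cast; linarith only [h0.2, h1.1, hI1, hI2]
      have hdvd : (((2 * S + 1 : ℕ) : ℤ)) ∣ e₀.1 0 + t - e'.1 0 := by
        have h := hproj
        rwa [← neg_sub, dvd_neg] at h
      exact absurd (Int.le_of_dvd hpos hdvd) (not_le.2 hlt')
    -- (iii) the cube-influence bound on `ℤ⁴` and the covariance bound on the torus
    have hinfl := hKA L
    rw [← hΛ] at hinfl
    have hcov := FiniteSizeCriterion.abs_latticeConnectedCorr_le_of_influence r.ρ r.continuous β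
      (M := 2 * S + 1) Λ A.measurable B.measurable hCA hCB A.isCylinder B.isCylinder t hinj hfar
      (fun η η' => hinfl η η')
    -- (iv) compare with `C e^{−m t}` using `L = t − R_B − 1`
    have hLr : (L : ℝ) + RB + 1 = t := by exact_mod_cast hLt
    have hexp : Real.exp (-(m * L)) = Real.exp (m * (RB + 1)) * Real.exp (-(m * t)) := by
      rw [← Real.exp_add, ← hLr]
      ring_nf
    calc |latticeConnectedCorr r.ρ β (2 * S + 1) A.F B.F t| ≤ CB * (KA * Real.exp (-(m * L))) := hcov
      _ = 0 + CB * KA * Real.exp (m * (RB + 1)) * Real.exp (-(m * t)) := by rw [hexp]; ring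
      _ ≤ 2 * CA * CB * Real.exp (m * (RA + RB + 2)) * Real.exp (-(m * t)) +
            CB * KA * Real.exp (m * (RB + 1)) * Real.exp (-(m * t)) := by
          gcongr
          positivity
      _ = (2 * CA * CB * Real.exp (m * (RA + RB + 2)) + CB * KA * Real.exp (m * (RB + 1))) *
            Real.exp (-(m * t)) := by ring

end Summit.QuantumFields.YangMills.Theorems.NonSimplyConnectedLatticeGap

end
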